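import Literature.NumberTheory.Transcendental.BallRivoalLinearForms
import HarnessLib

/-!
# Ball–Rivoal series, IV: Stirling-type estimate for `log R_n(k)`

Topic `Literature/NumberTheory/Transcendental`. Continuation of `BallRivoalLinearForms.lean`,
toward the discharge of **periods.S19** (`Literature.NumberTheory.Transcendental.ball_rivoal`).
Rivoal obtains `lim |S_n(1)|^{1/n}` from a Beukers-type integral representation
([Rivoal2000, Lemme 2 and Lemme 3]); we replace this by the elementary observation that all the
terms `R_n(k)` (`k ≥ rn`) of `S_n(1)` are nonnegative, so that `log S_n(1)` is governed by the
largest term. This file provides the pointwise estimate: for `n ≥ 1` and `k ≥ rn`,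

`|log R_n(k) - n φ(k/n)| ≤ (5a+6) (log(k + (r+1)n + 2) + 1)`            (`abs_log_R_sub_le`)

where `φ(x) = (a+1) x log x - (a+1)(x+1) log(x+1) + (x+r+1) log(x+r+1) - (x-r) log(x-r)`
(`phi`), from the two-sided Stirling bounds `m log m - m ≤ log m! ≤ (m+1) log(m+1) - m`
(`psi_le_log_factorial`, `log_factorial_le`) and the factorial form of `R_n(k)`
(`R_natCast_eq_factorial`). Everything is PROVED; no named facts.

## References

* [Rivoal2000] T. Rivoal, C. R. Acad. Sci. Paris Sér. I 331 (2000) 267–270, arXiv:math/0008051,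
  §2 Lemme 3 (the statement `lim |S_n(1)|^{1/n}` exists, proved there differently).
-/

noncomputable section

open Finset Real

namespace Literature.NumberTheory.Transcendental

namespace BallRivoal

/-! ### Two-sided Stirling bounds -/

/-- `g(y) = y log y` (with Mathlib's `log 0 = 0`, so `g 0 = 0`). [folklore] -/
def gxlog (y : ℝ) : ℝ := y * Real.log y

/-- `0 ≤ g(y+1) - g(y) ≤ log(y+1) + 1` for `y ≥ 0`. [folklore] -/
theorem gxlog_succ_sub (y : ℝ) (hy : 0 ≤ y) :
    0 ≤ gxlog (y + 1) - gxlog y ∧ gxlog (y + 1) - gxlog y ≤ Real.log (y + 1) + 1 := by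
  unfold gxlog
  rcases hy.eq_or_lt with rfl | hpos
  · simp
  · have h1 : Real.log y ≤ Real.log (y + 1) := Real.log_le_log hpos (by linarith)
    have h2 : y * (Real.log (y + 1) - Real.log y) ≤ 1 := by
      have hq : 0 < (y + 1) / y := by positivity
      have := Real.log_le_sub_one_of_pos hq
      rw [Real.log_div (by linarith) hpos.ne'] at this
      have e : (y + 1) / y - 1 = 1 / y := by
        field_simp
        ring
      rw [e] at this
      have := mul_le_mul_of_nonneg_left this hy
      rwa [mul_one_div_cancel hpos.ne'] at this
    have h3 : 0 ≤ Real.log (y + 1) := Real.log_nonneg (by linarith)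
    constructor <;> nlinarith

/-- `ψ(y) = y log y - y`. [folklore] -/
def psi (y : ℝ) : ℝ := y * Real.log y - y

/-- **Lower Stirling bound**: `m log m - m ≤ log m!` (from `m^m/m! ≤ e^m`). [folklore] -/
theorem psi_le_log_factorial (m : ℕ) : psi m ≤ Real.log (m.factorial : ℝ) := by
  rcases Nat.eq_zero_or_pos m with rfl | hm
  · simp [psi]
  · have hmr : (0 : ℝ) < m := by exact_mod_cast hm
    have hf : (0 : ℝ) < m.factorial := by exact_mod_cast Nat.factorial_pos m
    have h := Real.pow_div_factorial_le_exp (x := (m : ℝ)) hmr.le m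
    rw [div_le_iff₀ hf] at h
    have h2 := Real.log_le_log (by positivity) h
    rw [Real.log_pow, Real.log_mul (Real.exp_pos _).ne' hf.ne', Real.log_exp] at h2
    unfold psi
    linarith

/-- **Upper Stirling bound**: `log m! ≤ (m+1) log(m+1) - m`, by induction
(`1 ≤ (m+2) log((m+2)/(m+1))`). [folklore] -/
theorem log_factorial_le (m : ℕ) :
    Real.log (m.factorial : ℝ) ≤ ((m : ℝ) + 1) * Real.log ((m : ℝ) + 1) - m := by
  induction m with
  | zero => simp
  | succ m ih =>
    have hpos : (0 : ℝ) < (m : ℝ) + 1 := by positivity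
    have hlog : 1 / ((m : ℝ) + 2) ≤ Real.log ((m : ℝ) + 2) - Real.log ((m : ℝ) + 1) := by
      have hx : (0 : ℝ) < ((m : ℝ) + 1) / ((m : ℝ) + 2) := by positivity
      have := Real.log_le_sub_one_of_pos hx
      rw [Real.log_div hpos.ne' (by positivity)] at this
      have e2 : ((m : ℝ) + 1) / ((m : ℝ) + 2) - 1 = -(1 / ((m : ℝ) + 2)) := by
        field_simp
        ring
      rw [e2] at this
      linarith
    have h2 : (1 : ℝ) ≤ ((m : ℝ) + 2) * (Real.log ((m : ℝ) + 2) - Real.log ((m : ℝ) + 1)) := by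
      have := mul_le_mul_of_nonneg_left hlog (by positivity : (0 : ℝ) ≤ (m : ℝ) + 2)
      rwa [mul_one_div_cancel (by positivity)] at this
    rw [Nat.factorial_succ, Nat.cast_mul, Real.log_mul (by positivity) (by positivity)]
    push_cast
    rw [show ((m : ℝ) + 1 + 1) = (m : ℝ) + 2 by ring]
    linarith [ih, h2]

/-- The sandwich: `ψ(m) ≤ log m! ≤ ψ(m) + log(m+1) + 1`. [folklore] -/
theorem log_factorial_sub_psi (m : ℕ) :
    0 ≤ Real.log (m.factorial : ℝ) - psi m ∧
      Real.log (m.factorial : ℝ) - psi m ≤ Real.log ((m : ℝ) + 1) + 1 := by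
  refine ⟨by linarith [psi_le_log_factorial m], ?_⟩
  have h1 := log_factorial_le m
  have h2 := (gxlog_succ_sub (m : ℝ) (by positivity)).2
  unfold gxlog at h2
  unfold psi
  linarith

/-! ### `R_n(k)` in factorial form -/

/-- A Pochhammer value at a natural number is an ascending factorial. [folklore] -/
theorem poch_natCast (N k : ℕ) : poch (N : ℚ) k = (N.ascFactorial k : ℚ) := by
  rw [poch, Nat.ascFactorial_eq_prod_range, Nat.cast_prod]
  exact prod_congr rfl fun s _ => by push_cast; ring

/-- **Factorial form of `R_n(k)`** for naturals `k ≥ rn`: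
`R_n(k) = n!^{a-2r} · k!/(k-rn)! · (k+n+1+rn)!/(k+n+1)! · (k!/(k+n+1)!)^a`. [folklore] -/
theorem R_natCast_eq_factorial (a r n k : ℕ) (hk : r * n ≤ k) :
    R a r n k = (n.factorial : ℚ) ^ (a - 2 * r) *
      ((k.factorial : ℚ) / ((k - r * n).factorial : ℚ)) *
      (((k + n + 1 + r * n).factorial : ℚ) / ((k + n + 1).factorial : ℚ)) *
      ((k.factorial : ℚ) / ((k + n + 1).factorial : ℚ)) ^ a := by
  have h1 : poch ((k : ℚ) - r * n + 1) (r * n) = (k.factorial : ℚ) / ((k - r * n).factorial : ℚ) := by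
    rw [eq_div_iff (by positivity)]
    have e : ((k : ℚ) - r * n + 1) = ((k - r * n + 1 : ℕ) : ℚ) := by
      rw [Nat.cast_add, Nat.cast_sub hk]
      push_cast
      ring
    rw [e, poch_natCast]
    have := Nat.factorial_mul_ascFactorial (k - r * n) (r * n)
    rw [Nat.sub_add_cancel hk] at this
    rw [mul_comm]
    exact_mod_cast this
  have h2 : poch ((k : ℚ) + n + 2) (r * n) =
      ((k + n + 1 + r * n).factorial : ℚ) / ((k + n + 1).factorial : ℚ) := by
    rw [eq_div_iff (by positivity)]
    have e : ((k : ℚ) + n + 2) = ((k + n + 1 + 1 : ℕ) : ℚ) := by push_cast; ring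
    rw [e, poch_natCast, mul_comm]
    exact_mod_cast Nat.factorial_mul_ascFactorial (k + n + 1) (r * n)
  have h3 : poch ((k : ℚ) + 1) (n + 1) = ((k + n + 1).factorial : ℚ) / (k.factorial : ℚ) := by
    rw [eq_div_iff (by positivity)]
    have e : ((k : ℚ) + 1) = ((k + 1 : ℕ) : ℚ) := by push_cast; ring
    rw [e, poch_natCast, mul_comm]
    have := Nat.factorial_mul_ascFactorial k (n + 1)
    rw [show k + (n + 1) = k + n + 1 by ring] at this
    exact_mod_cast this
  rw [R, h1, h2, h3]
  have hk0 : (k.factorial : ℚ) ≠ 0 := by positivity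
  have hkn : ((k + n + 1).factorial : ℚ) ≠ 0 := by positivity
  rw [div_pow, div_pow, div_div_eq_mul_div]
  field_simp

/-! ### The rate function `φ` and the pointwise estimate -/

/-- Rivoal's rate function in the elementary approach:
`φ(x) = (a+1) x log x - (a+1)(x+1)log(x+1) + (x+r+1)log(x+r+1) - (x-r)log(x-r)`, the limit of
`(1/n) log R_n(xn)`. [folklore] -/
def phi (a r : ℕ) (x : ℝ) : ℝ :=
  (a + 1) * gxlog x - (a + 1) * gxlog (x + 1) + gxlog (x + r + 1) - gxlog (x - r)

/-- `φ` is continuous. [folklore] -/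
theorem continuous_phi (a r : ℕ) : Continuous (phi a r) := by
  unfold phi gxlog
  have hc : Continuous fun y : ℝ => y * Real.log y := Real.continuous_mul_log
  fun_prop

/-- Scaling: `n g(y/n) = g(y) - y log n` for `y ≥ 0`, `n > 0`. [folklore] -/
theorem mul_gxlog_div {y n : ℝ} (hy : 0 ≤ y) (hn : 0 < n) :
    n * gxlog (y / n) = gxlog y - y * Real.log n := by
  unfold gxlog
  rcases hy.eq_or_lt with rfl | hpos
  · simp
  · rw [Real.log_div hpos.ne' hn.ne']
    field_simp

/-- **The pointwise Stirling estimate for `R_n(k)`**: for `n ≥ 1` and `k ≥ rn`,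
`|log R_n(k) - n φ(k/n)| ≤ (5a+6)(log(k+(r+1)n+2) + 1)`. [folklore] -/
theorem abs_log_R_sub_le (a r n k : ℕ) (hn : 1 ≤ n) (hk : r * n ≤ k) (har : 2 * r ≤ a) :
    |Real.log (R a r n k : ℝ) - n * phi a r ((k : ℝ) / n)| ≤
      (5 * a + 6) * (Real.log ((k : ℝ) + (r + 1) * n + 2) + 1) := by
  -- notation
  set L : ℕ → ℝ := fun m => Real.log (m.factorial : ℝ) with hL
  set δ : ℝ := Real.log ((k : ℝ) + (r + 1) * n + 2) + 1 with hδ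
  have hnr : (0 : ℝ) < n := by exact_mod_cast hn
  have hk0 : (0 : ℝ) ≤ k := by positivity
  have hkr : ((r * n : ℕ) : ℝ) ≤ k := by exact_mod_cast hk
  push_cast at hkr
  have hrn0 : (0 : ℝ) ≤ (r : ℝ) * n := by positivity
  -- the log of the factorial form
  have hRpos : ∀ m : ℕ, (0 : ℝ) < (m.factorial : ℝ) := fun m => by exact_mod_cast Nat.factorial_pos m
  have hlogR : Real.log (R a r n k : ℝ) =
      (a - 2 * r : ℕ) * L n + (L k - L (k - r * n)) + (L (k + n + 1 + r * n) - L (k + n + 1)) +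
        a * (L k - L (k + n + 1)) := by
    have h := R_natCast_eq_factorial a r n k hk
    have h' : ((R a r n k : ℚ) : ℝ) = (n.factorial : ℝ) ^ (a - 2 * r) *
        ((k.factorial : ℝ) / ((k - r * n).factorial : ℝ)) *
        (((k + n + 1 + r * n).factorial : ℝ) / ((k + n + 1).factorial : ℝ)) *
        ((k.factorial : ℝ) / ((k + n + 1).factorial : ℝ)) ^ a := by
      rw [h]
      push_cast
      ring
    rw [h', Real.log_mul (by positivity) (by positivity), Real.log_mul (by positivity) (by positivity),
      Real.log_mul (by positivity) (by positivity), Real.log_pow, Real.log_pow,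
      Real.log_div (hRpos _).ne' (hRpos _).ne', Real.log_div (hRpos _).ne' (hRpos _).ne',
      Real.log_div (hRpos _).ne' (hRpos _).ne']
  -- Stirling for each factorial
  have hS := fun m : ℕ => log_factorial_sub_psi m
  -- monotonicity of the error terms: all arguments are ≤ k + (r+1)n + 1
  have hmono : ∀ m : ℕ, (m : ℝ) ≤ (k : ℝ) + (r + 1) * n + 1 →
      Real.log ((m : ℝ) + 1) + 1 ≤ δ := by
    intro m hm
    rw [hδ]
    have : Real.log ((m : ℝ) + 1) ≤ Real.log ((k : ℝ) + (r + 1) * n + 2) :=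
      Real.log_le_log (by positivity) (by linarith)
    linarith
  have hδ1 : 1 ≤ δ := by
    rw [hδ]
    have : 0 ≤ Real.log ((k : ℝ) + (r + 1) * n + 2) := Real.log_nonneg (by linarith)
    linarith
  -- the five factorials
  have bn := hS n
  have bk := hS k
  have bkr := hS (k - r * n)
  have bK1 := hS (k + n + 1 + r * n)
  have bK2 := hS (k + n + 1)
  have dn := hmono n (by linarith)
  have dk := hmono k (by linarith)
  have dkr : Real.log (((k - r * n : ℕ) : ℝ) + 1) + 1 ≤ δ := hmono (k - r * n) (by
    rw [Nat.cast_sub hk]; push_cast; linarith)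
  have dK1 : Real.log (((k + n + 1 + r * n : ℕ) : ℝ) + 1) + 1 ≤ δ := hmono _ (by push_cast; linarith)
  have dK2 : Real.log (((k + n + 1 : ℕ) : ℝ) + 1) + 1 ≤ δ := hmono _ (by push_cast; linarith)
  -- the main terms: Ψ - n φ(k/n) = a + Δ₁ - (a+1) Δ₂
  have hkrn : (((k - r * n : ℕ)) : ℝ) = (k : ℝ) - r * n := by rw [Nat.cast_sub hk]; push_cast; ring
  have hphi : (n : ℝ) * phi a r ((k : ℝ) / n) =
      (a + 1) * gxlog k - (a + 1) * gxlog ((k : ℝ) + n) + gxlog ((k : ℝ) + (r + 1) * n) -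
        gxlog ((k : ℝ) - r * n) + (a - 2 * r : ℕ) * ((n : ℝ) * Real.log n) := by
    have e1 : (k : ℝ) / n + 1 = ((k : ℝ) + n) / n := by field_simp
    have e2 : (k : ℝ) / n + r + 1 = ((k : ℝ) + (r + 1) * n) / n := by
      field_simp
      ring
    have e3 : (k : ℝ) / n - r = ((k : ℝ) - r * n) / n := by field_simp
    rw [phi, e1, e2, e3]
    have g1 := mul_gxlog_div hk0 hnr
    have g2 := mul_gxlog_div (by positivity : (0 : ℝ) ≤ (k : ℝ) + n) hnr
    have g3 := mul_gxlog_div (by positivity : (0 : ℝ) ≤ (k : ℝ) + (r + 1) * n) hnr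
    have g4 := mul_gxlog_div (by linarith : (0 : ℝ) ≤ (k : ℝ) - r * n) hnr
    have ecast : ((a - 2 * r : ℕ) : ℝ) = (a : ℝ) - 2 * r := by
      rw [Nat.cast_sub har]
      push_cast
      ring
    rw [ecast]
    calc (n : ℝ) * ((a + 1) * gxlog ((k : ℝ) / n) - (a + 1) * gxlog (((k : ℝ) + n) / n) +
          gxlog (((k : ℝ) + (r + 1) * n) / n) - gxlog (((k : ℝ) - r * n) / n))
        = (a + 1) * ((n : ℝ) * gxlog ((k : ℝ) / n)) - (a + 1) * ((n : ℝ) * gxlog (((k : ℝ) + n) / n)) +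
          (n : ℝ) * gxlog (((k : ℝ) + (r + 1) * n) / n) - (n : ℝ) * gxlog (((k : ℝ) - r * n) / n) := by
          ring
      _ = _ := by rw [g1, g2, g3, g4]; ring
  -- increments of g
  have hΔ1 := gxlog_succ_sub ((k : ℝ) + (r + 1) * n) (by positivity)
  have hΔ2 := gxlog_succ_sub ((k : ℝ) + n) (by positivity)
  have dΔ1 : Real.log ((k : ℝ) + (r + 1) * n + 1) + 1 ≤ δ := by
    rw [hδ]
    have : Real.log ((k : ℝ) + (r + 1) * n + 1) ≤ Real.log ((k : ℝ) + (r + 1) * n + 2) :=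
      Real.log_le_log (by positivity) (by linarith)
    linarith
  have dΔ2 : Real.log ((k : ℝ) + n + 1) + 1 ≤ δ := by
    rw [hδ]
    have : Real.log ((k : ℝ) + n + 1) ≤ Real.log ((k : ℝ) + (r + 1) * n + 2) :=
      Real.log_le_log (by positivity) (by linarith)
    linarith
  -- unfold ψ at the five arguments and conclude by linear arithmetic
  have pn : psi n = (n : ℝ) * Real.log n - n := rfl
  have pk : psi k = gxlog k - k := rfl
  have pkr : psi ((k - r * n : ℕ) : ℝ) = gxlog ((k : ℝ) - r * n) - ((k : ℝ) - r * n) := by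
    rw [hkrn]; rfl
  have pK1 : psi ((k + n + 1 + r * n : ℕ) : ℝ) = gxlog ((k : ℝ) + (r + 1) * n + 1) -
      ((k : ℝ) + (r + 1) * n + 1) := by
    have : ((k + n + 1 + r * n : ℕ) : ℝ) = (k : ℝ) + (r + 1) * n + 1 := by push_cast; ring
    rw [this]; rfl
  have pK2 : psi ((k + n + 1 : ℕ) : ℝ) = gxlog ((k : ℝ) + n + 1) - ((k : ℝ) + n + 1) := by
    have : ((k + n + 1 : ℕ) : ℝ) = (k : ℝ) + n + 1 := by push_cast; ring
    rw [this]; rfl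
  have ea : ((a - 2 * r : ℕ) : ℝ) = (a : ℝ) - 2 * r := by
    rw [Nat.cast_sub har]; push_cast; ring
  have ha0 : (0 : ℝ) ≤ a := by positivity
  have har' : (0 : ℝ) ≤ (a : ℝ) - 2 * r := by rw [← ea]; positivity
  rw [hlogR, hphi, ea, abs_le]
  simp only [hL]
  rw [pn] at bn
  rw [pk] at bk
  rw [pkr] at bkr
  rw [pK1] at bK1
  rw [pK2] at bK2
  have gn : gxlog (n : ℝ) = (n : ℝ) * Real.log n := rfl
  have m1 := mul_nonneg har' bn.1
  have m2 := mul_le_mul_of_nonneg_left (bn.2.trans dn) har'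
  have m3 := mul_nonneg ha0 bk.1
  have m4 := mul_le_mul_of_nonneg_left (bk.2.trans dk) ha0
  have m5 := mul_nonneg ha0 bK2.1
  have m6 := mul_le_mul_of_nonneg_left (bK2.2.trans dK2) ha0
  have m7 := mul_nonneg ha0 hΔ2.1
  have m8 := mul_le_mul_of_nonneg_left (hΔ2.2.trans dΔ2) ha0
  have m9 := mul_le_mul_of_nonneg_left hδ1 ha0
  have hδ0 : 0 ≤ δ := by linarith
  have m10 : 0 ≤ (a : ℝ) * δ := mul_nonneg ha0 hδ0
  have m11 : 0 ≤ (r : ℝ) * δ := mul_nonneg (by positivity) hδ0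
  constructor
  · linarith [bn.1, bn.2, bk.1, bk.2, bkr.1, bkr.2, bK1.1, bK1.2, bK2.1, bK2.2, hΔ1.1, hΔ1.2,
      hΔ2.1, hΔ2.2, dn, dk, dkr, dK1, dK2, dΔ1, dΔ2, hδ1]
  · linarith [bn.1, bn.2, bk.1, bk.2, bkr.1, bkr.2, bK1.1, bK1.2, bK2.1, bK2.2, hΔ1.1, hΔ1.2,
      hΔ2.1, hΔ2.2, dn, dk, dkr, dK1, dK2, dΔ1, dΔ2, hδ1, m10, m11]

end BallRivoal

end Literature.NumberTheory.Transcendental
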